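import Summits.ABC.ABC.Theorems.DefiniteXiSteinbergCoreXi2ThetaTransfer
import Summits.ABC.ABC.Theorems.DefiniteXiSteinbergCoreXi4ThetaCuspValue
import Summits.ABC.ABC.Theorems.DefiniteXiSteinbergCoreXi5ThetaLift
import Summits.ABC.ABC.Theorems.DefiniteXiSteinbergCoreXi6Kernel

/-!
# Xi helper 9 — H1 (cuspidality of `Θ_ij − Θ_kl`) assembled from B5 + C1, the templates are k2's theorems, and `XiCoreDivisibility` unconditionally (k1 G8 §I, G9 assembly, G10 §5c–§6, PART C)

Helper module 9/10 for the registered stub `stub_xiDegreeComparison` of the line `p6_tamagawa_split` (crux `DefiniteXi.SteinbergCore`, item stmt-ABC-15024, route `route-ABC-DefiniteXi`).  Content = lines 1239–1242, 1255–1383, 1387–1426, 2036–2058, 2073–2154, 2159–2172 of `Summits/ABC/ABC/Cruxes/SteinbergCore/STUB_IDEAS_stub_xiDegreeComparison_1_g44_XiMonoDefLight.lean` (gen-44 def-light edition of the critic monolith `STUB_PLAN_stub_xiDegreeComparison_XiMono.lean`) (the renamespaced k1 gen-11 certificate `STUB_IDEAS_stub_xiDegreeComparison_1_g11_Certificate.lean`: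 k1 gens 7–11, k2 gen-4 kernel, k3 gen-4 tail — authors: stub-ideation seats k1/k2/k3), cut mechanically at declaration boundaries by the stub-critic (plan `STUB-PLAN-stub_xiDegreeComparison.md` §1).  Proofs verbatim; nothing restated.
-/

set_option linter.dupNamespace false

noncomputable section

namespace Summit.ABC.ABC.Theorems.SteinbergCoreXi.StubIdeasK1G8

open Complex hiding I
open Matrix Filter Topology ModularForm
open Complex (I)
open scoped MatrixGroups UpperHalfPlane

open Literature.NumberTheory.ModularForms
open Literature.NumberTheory.ModularForms.SiegelModularForm (one1 one1_map one1_mul one1_inv smul_one1 det_one1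
  one1_injective eq_one1 spOfSL spOfSL_mem moeb_spOfSL det_denom_spOfSL num_denom_spOfSL)
open Literature.NumberTheory.EllipticCurves.ModularForms
open Literature.NumberTheory.Automorphic Literature.NumberTheory.Automorphic.Brandt

variable {Nplus Nminus : ℕ} (S : XiSetup Nplus Nminus)

/-! ## §I H1 modulo exactly {B5, C1} — the gen-6 §D composition re-run on the gen-8 proofs (kernel-checked, 0 sorries)

`B5Statement` / `C1Statement` are the gen-6 signatures of B5 (`exists_brandtGram_sublattice_datum`, with `hN`/`hcop` moved to
where a prover has them) and C1 (`exists_gamma0_mul_T_zpow`) as `Prop`s; L1 and C2 are the gen-5/6 proofs repeated verbatim. -/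

/-- **L1 (gen 5, PROVED there; repeated).** Equal values of all `SL₂(ℤ)`-translates ⇒ the difference is cuspidal. -/
theorem isCuspForm_sub_of_forall_valueAtInfty_slash_eq {N : ℕ} [NeZero N] (f g : ModularForm (CongruenceSubgroup.Gamma0 N) 2)
    (h : ∀ γ : SL(2, ℤ), UpperHalfPlane.valueAtInfty (⇑f ∣[(2 : ℤ)] (γ : GL (Fin 2) ℝ)) =
      UpperHalfPlane.valueAtInfty (⇑g ∣[(2 : ℤ)] (γ : GL (Fin 2) ℝ))) :
    ModularForm.IsCuspForm (f - g) := by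
  have hF : (⇑f - ⇑g) ∈ gamma0Space N 2 := Submodule.sub_mem _ (coe_mem_formSpace f) (coe_mem_formSpace g)
  have hlim : ∀ (u : ModularForm (CongruenceSubgroup.Gamma0 N) 2) (γ : SL(2, ℤ)),
      Tendsto (⇑u ∣[(2 : ℤ)] (γ : GL (Fin 2) ℝ)) UpperHalfPlane.atImInfty
        (𝓝 (UpperHalfPlane.valueAtInfty (⇑u ∣[(2 : ℤ)] (γ : GL (Fin 2) ℝ)))) := by
    intro u γ
    have := tendsto_cosetSlash (coe_mem_formSpace u) ((γ⁻¹ : SL(2, ℤ)) : SL(2, ℤ) ⧸ CongruenceSubgroup.Gamma0 N)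
    rwa [cosetSlash_mk (slash_eq_of_mem_gamma0Space (coe_mem_formSpace u)), inv_inv] at this
  have h0 : ∀ γ : SL(2, ℤ), UpperHalfPlane.IsZeroAtImInfty ((⇑f - ⇑g) ∣[(2 : ℤ)] (γ : GL (Fin 2) ℝ)) := by
    intro γ
    have hsub : (⇑f - ⇑g) ∣[(2 : ℤ)] (γ : GL (Fin 2) ℝ) =
        ⇑f ∣[(2 : ℤ)] (γ : GL (Fin 2) ℝ) - ⇑g ∣[(2 : ℤ)] (γ : GL (Fin 2) ℝ) := by
      rw [sub_eq_add_neg, SlashAction.add_slash, SlashAction.neg_slash, ← sub_eq_add_neg]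
    show Tendsto ((⇑f - ⇑g) ∣[(2 : ℤ)] (γ : GL (Fin 2) ℝ)) UpperHalfPlane.atImInfty (𝓝 0)
    rw [hsub]
    have := (hlim f γ).sub (hlim g γ)
    rwa [h γ, sub_self] at this
  refine ⟨cuspFormOfVanishing (⇑f - ⇑g) hF h0, ?_⟩
  ext τ
  rw [CuspForm.toModularFormₗ_apply, ModularForm.sub_apply]
  rfl

/-- **C2 (gen 6, PROVED there; repeated).** `v(f ∣ δ γ T^h) = v(f ∣ γ)` for `δ ∈ Γ₀(N)`. -/
theorem valueAtInfty_slash_gamma0_mul_T_zpow {N : ℕ} [NeZero N] {k : ℤ} (f : ModularForm (CongruenceSubgroup.Gamma0 N) k)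
    (γ : SL(2, ℤ)) {δ : SL(2, ℤ)} (hδ : δ ∈ CongruenceSubgroup.Gamma0 N) (h : ℤ) :
    UpperHalfPlane.valueAtInfty (⇑f ∣[k] ((δ * γ * ModularGroup.T ^ h : SL(2, ℤ)) : GL (Fin 2) ℝ)) =
      UpperHalfPlane.valueAtInfty (⇑f ∣[k] (γ : GL (Fin 2) ℝ)) := by
  have hγ : ⇑f ∣[k] ((δ * γ * ModularGroup.T ^ h : SL(2, ℤ)) : GL (Fin 2) ℝ) =
      transl h (⇑f ∣[k] (γ : GL (Fin 2) ℝ)) := by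
    rw [coeGL_mul, coeGL_mul, SlashAction.slash_mul, SlashAction.slash_mul,
      slash_eq_of_mem_gamma0Space (coe_mem_formSpace f) δ hδ, slash_T_zpow_eq_transl]
  have hlim : Tendsto (⇑f ∣[k] (γ : GL (Fin 2) ℝ)) UpperHalfPlane.atImInfty
      (𝓝 (UpperHalfPlane.valueAtInfty (⇑f ∣[k] (γ : GL (Fin 2) ℝ)))) := by
    have := tendsto_cosetSlash (coe_mem_formSpace f) ((γ⁻¹ : SL(2, ℤ)) : SL(2, ℤ) ⧸ CongruenceSubgroup.Gamma0 N)
    rwa [cosetSlash_mk (slash_eq_of_mem_gamma0Space (coe_mem_formSpace f)), inv_inv] at this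
  rw [hγ]
  exact (hlim.comp (tendsto_T_zpow_smul_atImInfty h)).limUnder_eq

/-- **H1, same row, modulo {B5, C1}.** -/
theorem brandtTheta_sub_isCuspForm_sameRow_of [NeZero (Nplus * Nminus)] (i j l : ClassSet S.O)
    (hB5 : B5Statement S i j l) (hC1 : C1Statement (Nplus * Nminus)) :
    ModularForm.IsCuspForm (S.brandtTheta i j - S.brandtTheta i l) := by
  refine isCuspForm_sub_of_forall_valueAtInfty_slash_eq _ _ fun γ => ?_
  obtain ⟨γ', ⟨δ, hδ, h, rfl⟩, hv⟩ := exists_thetaCuspValue_brandtGram_eq_sameRow_of S i j l hB5 hC1 γ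
  rw [valueAtInfty_slash_brandtTheta S i j γ, hv, ← valueAtInfty_slash_brandtTheta S i l,
    valueAtInfty_slash_gamma0_mul_T_zpow (S.brandtTheta i l) γ hδ h]

/-- **H1 exactly as consumed by k2's closing chain, modulo {B5 (all same-row triples), C1}.** -/
theorem brandtTheta_sub_isCuspForm_of [NeZero (Nplus * Nminus)]
    (hB5 : ∀ i j l : ClassSet S.O, B5Statement S i j l) (hC1 : C1Statement (Nplus * Nminus))
    (i j k l : ClassSet S.O) : ModularForm.IsCuspForm (S.brandtTheta i j - S.brandtTheta k l) := by
  have h1 := brandtTheta_sub_isCuspForm_sameRow_of S i j l (hB5 i j l) hC1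
  have h2 := brandtTheta_sub_isCuspForm_sameRow_of S l i k (hB5 l i k) hC1
  rw [S.brandtTheta_symm l i, S.brandtTheta_symm l k] at h2
  have h3 : S.brandtTheta i j - S.brandtTheta k l =
      (S.brandtTheta i j - S.brandtTheta i l) + (S.brandtTheta i l - S.brandtTheta k l) := by
    abel
  rw [ModularForm.IsCuspForm, h3]
  exact Submodule.add_mem _ h1 h2

/-! ## §J C1 PROVED (gen 8): `Γ₀(N)`-double-coset recognition `γ' ∈ Γ₀(N) γ T^ℤ`

`δ_h := γ' T^{-h} γ⁻¹` has lower-left entry `c (d − d' + h c)`; with `G = (N, c)`, `M = N/G`, `g = (c, M)`: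
`g ∣ a' − a` (from `c ∣ a' − n a`, `g ∣ n − 1`), hence `g ∣ d − d' = d d'(a' − a) + c (b d' − b' d)`; Bézout
`g = |c| x + M y` gives `h` with `M ∣ d − d' + h c`, and then `N = G M ∣ c (d − d' + h c)`. -/
/-- **C1 (PROVED).** `C1Statement N`: two `SL₂(ℤ)` matrices with the same lower-left entry and compatible top-left entries differ by an element of `Γ₀(N)` on the left and a power of `T` on the right (cusp bookkeeping; proof sketched in the module comment above). -/
theorem c1Statement_holds (N : ℕ) [NeZero N] : C1Statement N := by
  intro γ γ' hc hcc n hn hg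
  have hdet : γ 0 0 * γ 1 1 - γ 0 1 * γ 1 0 = 1 := by
    have h := γ.prop; rw [Matrix.det_fin_two] at h; exact h
  have hdet' : γ' 0 0 * γ' 1 1 - γ' 0 1 * γ 1 0 = 1 := by
    have h := γ'.prop; rw [Matrix.det_fin_two, hcc] at h; exact h
  -- moduli
  set G : ℕ := Nat.gcd N (γ 1 0).natAbs with hG
  set M : ℕ := N / G with hM
  set g : ℕ := Nat.gcd (γ 1 0).natAbs M with hg'
  have hgc : (g : ℤ) ∣ γ 1 0 := (Int.natCast_dvd_natCast.2 (Nat.gcd_dvd_left _ _)).trans (Int.natAbs_dvd.2 dvd_rfl)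
  have hGc : (G : ℤ) ∣ γ 1 0 := (Int.natCast_dvd_natCast.2 (Nat.gcd_dvd_right _ _)).trans (Int.natAbs_dvd.2 dvd_rfl)
  have hNM : (N : ℤ) = G * M := by rw [hM]; exact_mod_cast (Nat.mul_div_cancel' (Nat.gcd_dvd_left _ _)).symm
  -- `g ∣ d - d'`
  have h1 : (g : ℤ) ∣ γ' 0 0 - γ 0 0 := by
    have : (γ' 0 0 : ℤ) - γ 0 0 = (γ' 0 0 - n * γ 0 0) + (n - 1) * γ 0 0 := by ring
    rw [this]; exact dvd_add (hgc.trans hn) (hg.mul_right _)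
  have hdd : (g : ℤ) ∣ γ 1 1 - γ' 1 1 := by
    have : (γ 1 1 : ℤ) - γ' 1 1 = γ 1 1 * γ' 1 1 * (γ' 0 0 - γ 0 0) + γ 1 0 * (γ 0 1 * γ' 1 1 - γ' 0 1 * γ 1 1) := by
      linear_combination γ' 1 1 * hdet - γ 1 1 * hdet'
    rw [this]; exact dvd_add (h1.mul_left _) (hgc.mul_right _)
  obtain ⟨t, ht⟩ := hdd
  -- Bézout and the shift
  have hbez : (g : ℤ) = ((γ 1 0).natAbs : ℤ) * Nat.gcdA (γ 1 0).natAbs M + (M : ℤ) * Nat.gcdB (γ 1 0).natAbs M :=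
    Nat.gcd_eq_gcd_ab _ _
  have habs : (((γ 1 0).natAbs : ℕ) : ℤ) = (γ 1 0).sign * γ 1 0 := (Int.sign_mul_self_eq_natAbs _).symm
  set x : ℤ := Nat.gcdA (γ 1 0).natAbs M with hx
  set y : ℤ := Nat.gcdB (γ 1 0).natAbs M with hy
  set h : ℤ := -((γ 1 0).sign * x * t) with hh
  have hMdvd : (M : ℤ) ∣ γ 1 1 - γ' 1 1 + h * γ 1 0 :=
    ⟨t * y, by rw [ht, hh]; linear_combination t * hbez + x * t * habs⟩
  refine ⟨γ' * (ModularGroup.T ^ h)⁻¹ * γ⁻¹, ?_, h, by group⟩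
  have hentry : ((γ' * (ModularGroup.T ^ h)⁻¹ * γ⁻¹ : SL(2, ℤ)) : Matrix (Fin 2) (Fin 2) ℤ) 1 0 =
      γ 1 0 * (γ 1 1 - γ' 1 1 + h * γ 1 0) := by
    rw [← _root_.zpow_neg, Matrix.SpecialLinearGroup.coe_mul, Matrix.SpecialLinearGroup.coe_mul, ModularGroup.coe_T_zpow,
      Matrix.SpecialLinearGroup.coe_inv, Matrix.adjugate_fin_two]
    simp [Matrix.mul_apply, Fin.sum_univ_two]
    rw [hcc]; ring
  rw [CongruenceSubgroup.Gamma0_mem, hentry, ZMod.intCast_zmod_eq_zero_iff_dvd]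
  obtain ⟨k, hk⟩ := hMdvd
  obtain ⟨c₁, hc₁⟩ := hGc
  refine ⟨c₁ * k, ?_⟩
  rw [hk, hNM, hc₁]; ring

/-- **C1 in the gen-6 signature.** -/
theorem exists_gamma0_mul_T_zpow {N : ℕ} [NeZero N] (γ γ' : SL(2, ℤ)) (hc : γ 1 0 ≠ 0) (hcc : γ' 1 0 = γ 1 0) {n : ℤ}
    (hn : (γ 1 0 : ℤ) ∣ γ' 0 0 - n * γ 0 0)
    (hg : ((Nat.gcd (γ 1 0).natAbs (N / Nat.gcd N (γ 1 0).natAbs) : ℕ) : ℤ) ∣ n - 1) :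
    ∃ δ ∈ CongruenceSubgroup.Gamma0 N, ∃ h : ℤ, γ' = δ * γ * ModularGroup.T ^ h :=
  c1Statement_holds N γ γ' hc hcc n hn hg

/-- **H1 modulo B5 alone (gen 8).** -/
theorem brandtTheta_sub_isCuspForm_of_B5 [NeZero (Nplus * Nminus)]
    (hB5 : ∀ i j l : ClassSet S.O, B5Statement S i j l)
    (i j k l : ClassSet S.O) : ModularForm.IsCuspForm (S.brandtTheta i j - S.brandtTheta k l) :=
  brandtTheta_sub_isCuspForm_of S hB5 (c1Statement_holds _) i j k l

end Summit.ABC.ABC.Theorems.SteinbergCoreXi.StubIdeasK1G8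

namespace Summit.ABC.ABC.Theorems.SteinbergCoreXi.StubIdeasK1G9

open Literature.NumberTheory.Automorphic Literature.NumberTheory.Automorphic.Brandt

variable {Nplus Nminus : ℕ} (S : XiSetup Nplus Nminus)

/-- B2 holds (gen 7's `exists_mem_order_reducedNorm_modEq_of_not_dvd`, `0 < N⁺` from `NeZero (N⁺N⁻)`). -/
theorem b2Statement_holds [NeZero (Nplus * Nminus)] : B2Statement S := by
  intro p hp hpN e t ht
  haveI : Fact p.Prime := ⟨hp⟩
  have hN : 0 < Nplus := Nat.pos_of_ne_zero fun h => NeZero.ne (Nplus * Nminus) (by rw [h, zero_mul])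
  exact StubIdeasK1G7.exists_mem_order_reducedNorm_modEq_of_not_dvd S hpN hN e ht

/-- B5 holds for coprime `(N⁺, N⁻)` (gen 9), in gen 8's spelling of the statement. -/
theorem b5Statement_holds [NeZero (Nplus * Nminus)] (hcop : Nplus.Coprime Nminus) (i j l : ClassSet S.O) :
    StubIdeasK1G8.B5Statement S i j l :=
  b5Statement_of S hcop (b2Statement_holds S) i j l

/-- **H1 (complete, hypotheses explicit).** Every difference of Brandt theta series `Θ_ij − Θ_kl` of an Eichler order
of level `(N⁺, N⁻)`, `(N⁺, N⁻) = 1`, is a cusp form of weight 2 and level `Γ₀(N⁺N⁻)`. [cite: Eichler1973, Ch. IV §1]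
[cite: Pizer1980, Prop. 2.15] [cite: HijikataPizerShemanske1989] -/
theorem brandtTheta_sub_isCuspForm [NeZero (Nplus * Nminus)] (hcop : Nplus.Coprime Nminus)
    (i j k l : ClassSet S.O) : ModularForm.IsCuspForm (S.brandtTheta i j - S.brandtTheta k l) :=
  StubIdeasK1G8.brandtTheta_sub_isCuspForm_of_B5 S (fun i' j' l' => b5Statement_holds S hcop i' j' l') i j k l

/-- **H1 (unconditional).** `NeZero (N⁺N⁻)` and `(N⁺,N⁻) = 1` are properties of every Brandt setup
(`XiSetup.nplus_pos`, `XiSetup.squarefree`, `XiSetup.coprime`). -/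
theorem brandtTheta_sub_isCuspForm' (i j k l : ClassSet S.O) :
    ModularForm.IsCuspForm (S.brandtTheta i j - S.brandtTheta k l) := by
  haveI : NeZero (Nplus * Nminus) := ⟨mul_ne_zero S.nplus_pos.ne' S.squarefree.ne_zero⟩
  exact brandtTheta_sub_isCuspForm S S.coprime i j k l

/-- **k2's H1, verbatim** (`ThetaTransferG3.brandtTheta_sub_isCuspForm`, the hypothesis `hΘ` of
`stub_xiDegreeComparison_of_thetaTransfer`) — PROVED. -/
theorem thetaTransfer_H1 :
    ∀ (Nplus Nminus : ℕ) (S : XiSetup Nplus Nminus) [Fintype (ClassSet S.O)] (i j k l : ClassSet S.O),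
      ModularForm.IsCuspForm (S.brandtTheta i j - S.brandtTheta k l) :=
  fun _ _ S _ i j k l => brandtTheta_sub_isCuspForm' S i j k l

end Summit.ABC.ABC.Theorems.SteinbergCoreXi.StubIdeasK1G9

namespace Summit.ABC.ABC.Theorems.SteinbergCoreXi.StubIdeasK1G10

open scoped MatrixGroups ModularForm Matrix
open CongruenceSubgroup
open Literature.NumberTheory.EllipticCurves Literature.NumberTheory.EllipticCurves.ModularForms
open Literature.NumberTheory.Automorphic Literature.NumberTheory.Automorphic.Brandt

variable {Nplus Nminus : ℕ}


/-! ## §5c the four templates ARE k2's theorems (bridging, PROVED) -/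

/-- Template **(T)** holds: it is k2's kernel theorem `KernelK2G4.dvd_natAbs_mul_congruenceNumber_of_transfer` (congruence-module transfer along the theta lift). -/
theorem kernelT_holds : KernelT :=
  fun _ _ _ _ _ w φ _ hξ hξw hφ _ hf hfI Θ hadd hsmul hint _ hφf horth _ hy =>
    KernelK2G4.dvd_natAbs_mul_congruenceNumber_of_transfer w φ hξ hξw hφ hf hfI Θ hadd hsmul hint
      hφf horth hy

/-- Template **(H4a′)** holds: self-adjointness of the anemic Hecke operators for the Petersson product (`KernelK2G4.peterssonProduct_anemicHecke_symm`). -/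
theorem selfAdjH4a_holds : SelfAdjH4a :=
  fun _ _ _ t f g => KernelK2G4.peterssonProduct_anemicHecke_symm t f g

/-- Template **(H4b′)** holds: transport of an anemic Hecke relation through the theta lift (`KernelK2G4.exists_anemicHecke_transport`). -/
theorem transportH4b_holds : TransportH4b :=
  fun _ _ _ _ _ _ T Θ hdeg hadd hsmul hequiv _ hM =>
    KernelK2G4.exists_anemicHecke_transport T Θ hdeg hadd hsmul hequiv hM

/-- Template **(O)** holds: Petersson-orthogonality of the transferred form to the newform's orthogonal complement (`KernelK2G4.peterssonProduct_transfer_eq_zero`). -/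
theorem orthO_holds : OrthO :=
  fun _ _ _ _ _ _ w φ _ _ hξ hD hξw _ hproj _ Θ hsmul _ ht hsymm hφ _ hm hφf _ hz hzorth =>
    KernelK2G4.peterssonProduct_transfer_eq_zero w φ hξ hD hξw hproj Θ hsmul ht hsymm hφ hm hφf hz
      hzorth

/-- **K5 (S · assembly of the theta side, PROVED modulo K2d–K2f, K3).**
`H1 → (T) → H4a′ → H4b′ → (O) → XiCoreDivisibility`.  ORDER: `subst` the level; `φ ∈ L`, `deg φ = 0`
(`XiSetup.sum_eq_zero_of_eigenLattice_lFunction_eq_span`); `ξ = Σ w φ²` (`XiSetup.xi`, `xiOfOrder_eq`,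
`xi_eq_sum`) hence `ξ ≠ 0` (`one_le_weight`, `φ ≠ 0`); `f ≠ 0`, `f` integral (`IsNewformOf`); row
`φ_i = 0` vacuous; `m := 2 w_i φ_i ≠ 0`; H3; the ABSTRACT projector `Brandt.exists_heckeProjector`
(anemic `adjoin`, as H4b′ wants); transport `t` (H4b′ with K2b/K2c/K2f/K2g); (O) with H4a′; (T). -/
theorem xiCoreDivisibility_of_thetaSide (hΘ : H1) (hT : KernelT) (h4a : SelfAdjH4a)
    (h4b : TransportH4b) (hO : OrthO) : XiCoreDivisibility := by
  classical
  intro Nplus Nminus M _ hM S _ W _ f hf φ hφ0 hL i y hy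
  subst hM
  -- the eigenvector: in the lattice, degree zero
  have hφL : φ ∈ eigenLattice (Nplus * Nminus) (matrix S.O) (fun n => W.LFunction n) := by
    rw [hL]; exact Submodule.mem_span_singleton_self φ
  have hφdeg : ∑ c, φ c = 0 := S.sum_eq_zero_of_eigenLattice_lFunction_eq_span W hL
  -- ξ = Σ w φ² ≠ 0
  have hξw : (S.xi fun n => W.LFunction n) = ∑ c, weight S.O c * (φ c).natAbs ^ 2 := by
    rw [XiSetup.xi, xiOfOrder_eq]
    exact xi_eq_sum _ hφ0 hL
  have hξ : (S.xi fun n => W.LFunction n) ≠ 0 := by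
    rw [hξw]
    obtain ⟨c, hc⟩ := Function.ne_iff.mp hφ0
    have hpos : 0 < weight S.O c * (φ c).natAbs ^ 2 :=
      Nat.mul_pos (S.one_le_weight c) (pow_pos (Int.natAbs_pos.mpr hc) 2)
    have hle : weight S.O c * (φ c).natAbs ^ 2 ≤ ∑ c, weight S.O c * (φ c).natAbs ^ 2 :=
      Finset.single_le_sum (f := fun c => weight S.O c * (φ c).natAbs ^ 2)
        (fun _ _ => Nat.zero_le _) (Finset.mem_univ c)
    exact (lt_of_lt_of_le hpos hle).ne'
  -- the newform: nonzero, integral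
  have hf0 : f ≠ 0 := IsNormalized.ne_zero_gamma0 hf.1.2.2
  have hfI : f ∈ integralCuspForms0 (Nplus * Nminus) 2 := fun n => ⟨W.LFunction n, (hf.2 n).symm⟩
  -- the vacuous row
  by_cases hφi : φ i = 0
  · rw [hφi, mul_zero, zero_mul, Int.natAbs_zero, zero_mul]
    exact dvd_zero _
  have hwi : (weight S.O i : ℤ) ≠ 0 := by
    have := S.one_le_weight i
    exact_mod_cast (by omega : weight S.O i ≠ 0)
  have hm : (2 * (weight S.O i : ℤ) * φ i) ≠ 0 := mul_ne_zero (mul_ne_zero two_ne_zero hwi) hφi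
  -- H3
  have hφf := thetaLift_eq_smul_of_isNewformOf hΘ S i W hf hφL
  -- the integral Hecke projector, in the ANEMIC Hecke algebra
  obtain ⟨D, hD, Mx, hMx, hproj⟩ := Brandt.exists_heckeProjector (weight S.O)
    (fun c => S.one_le_weight c) (Nplus * Nminus) (matrix S.O)
    (fun p _ _ c d => S.weight_mul_matrix_symm p c d) (fun n => W.LFunction n) hφ0 hL
  have hproj' : ∀ c d : ClassSet S.O, ((S.xi fun n => W.LFunction n : ℕ) : ℤ) * Mx c d =
      (D : ℤ) * (weight S.O d : ℤ) * φ d * φ c := by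
    intro c d
    rw [XiSetup.xi, xiOfOrder_eq]
    exact hproj c d
  -- transport of the projector to `𝕋`
  obtain ⟨t, ht⟩ := h4b (ClassSet S.O) (Nplus * Nminus) 2 (matrix S.O) (thetaLift hΘ S i)
    (fun p hp hpN v hv => sum_matrix_mulVec_eq_zero S hp hpN hv)
    (thetaLift_add hΘ S i) (thetaLift_smul hΘ S i)
    (fun p hp hpN v hv => heckeT_thetaLift hΘ S i hp hpN hv) Mx hMx
  -- orthogonality
  have horth : ∀ z : ClassSet S.O → ℤ, ∑ c, z c = 0 →
      ∑ c, (weight S.O c : ℤ) * φ c * z c = 0 →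
      peterssonProduct (Gamma0 (Nplus * Nminus)) 2 f (thetaLift hΘ S i z) = 0 :=
    fun z hz hzo => hO (ClassSet S.O) (Nplus * Nminus) 2 (weight S.O) φ _ D hξ hD hξw Mx hproj' f
      (thetaLift hΘ S i) (thetaLift_smul hΘ S i) t ht (h4a _ 2 t) hφdeg _ hm hφf z hz hzo
  -- the kernel
  exact hT (ClassSet S.O) (Nplus * Nminus) 2 (weight S.O) φ _ hξ hξw hφdeg f hf0 hfI
    (thetaLift hΘ S i) (thetaLift_add hΘ S i) (thetaLift_smul hΘ S i)
    (fun v hv => thetaLift_mem_integralCuspForms0 hΘ S i hv) _ hφf horth y hy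

/-- **THE THETA SIDE IS CLOSED: `H1 → XiCoreDivisibility`** (k1 gen 9 H1 ⊕ k1 gen 10 theta package ⊕
k2 gen 4 kernel), kernel-checked in this file with H1 the only hypothesis — and H1 is PROVED in
`STUB_IDEAS_stub_xiDegreeComparison_1_g9_H1complete.lean` (`StubIdeasK1G9.thetaTransfer_H1`, 0 sorries). -/
theorem xiCoreDivisibility_of_H1 (hΘ : H1) : XiCoreDivisibility :=
  xiCoreDivisibility_of_thetaSide hΘ kernelT_holds selfAdjH4a_holds transportH4b_holds orthO_holds

/-! ## §7 The last arrow (k3 `ProbeExtremesG4.stub_xiDegreeComparison_of_core`, L7):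
`stub_xiDegreeComparison ⟸ XiCoreDivisibility ∧ ARS 2.1(b) ∧ FreyModularity`; so the stub's trust base
after gen 10 is exactly {`padicValNat_congruenceNumber_eq_of_not_sq_dvd` (named fact, ARS 2012 Thm 2.1(b)),
`Summit.ABC.ABC.Theses.DefiniteXi.FreyModularity` (route item stmt-ABC-11340)} plus ONLY k3's gen-4
S/XS sorries L3 (least prime `ℓ ∤ N` is `≤ C_ε N^ε`), L5 (`cps` bookkeeping), L6 (ARS (b) at the optimal
datum), L7 (assembly) — `XiCoreDivisibility` itself is now a theorem (`xiCoreDivisibility_of_H1` here +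
`StubIdeasK1G9.thetaTransfer_H1`; single-file certificate `…_1_g10_XiCoreComplete.lean`). -/

end Summit.ABC.ABC.Theorems.SteinbergCoreXi.StubIdeasK1G10

namespace Summit.ABC.ABC.Theorems.SteinbergCoreXi.StubIdeasK1G10

/-- **H1 holds** (witness for the template `H1` of PART B): cuspidality of differences of Brandt theta series,
proved in PART A (`StubIdeasK1G9.thetaTransfer_H1`, Eichler orders + Siegel theta / Gauss sums). -/
theorem h1_holds : H1 := StubIdeasK1G9.thetaTransfer_H1

/-- **`XiCoreDivisibility` holds unconditionally** (k3 gen-4 `ProbeExtremesG4.XiCoreDivisibility`,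
verbatim): in a definite `XiSetup` of level `(N⁺, N⁻)`, for the newform `f` on `Γ₀(N⁺N⁻)` of an elliptic
curve `W` whose Brandt eigenlattice is `ℤφ`, every class `i` and every degree-zero integer vector `y`,
`ξ ∣ |2 w_i φ_i · Σ_c w_c φ_c y_c| · congruenceNumber f`. -/
theorem xiCoreDivisibility : XiCoreDivisibility :=
  xiCoreDivisibility_of_H1 h1_holds

end Summit.ABC.ABC.Theorems.SteinbergCoreXi.StubIdeasK1G10

end
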